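import Mathlib
import HarnessLib

/-!
# The fork at [IUTchIII] Corollary 3.12, L-DH level: a LOPSIDED point family on the `λ`-line over `ℚ(i)` —
# V. (P2) by COUNTING: a prime `l ∈ (L, M]` dividing none of finitely many positive integers of bounded sum
# (Chebyshev's `θ`), and the numeric envelope of the witness

Proof-only file (D-0012; 0 definitions, no `Prop` fact) of the abc-iut cell (seat abc-iut-w5-d126, gen 5; row
«HABOVE-LOPSIDED-WITNESS», crux `ThetaPartII` = stmt-ABC-19678, (U) line, VERDICT RISK ¶7). TAKES NO SIDE on [IUTchIII]
Cor. 3.12 or [IUTchIV] Thm. 1.10; elementary real analysis and Chebyshev's bounds (Mathlib `Chebyshev.theta_ge`,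
`Chebyshev.theta_le_log4_mul_x`, `Chebyshev.pi_le_log4_mul_div`). S. Mochizuki, *IUT IV* [Mochizuki2012], Cor. 2.2 (ii) proof
(P1)–(P2) pp. 44–45 (print's own prime-selection-by-counting in the window `[√h, …]`; here the window is `(10^{13}, k/(5·10^8)]`).

WHY. Condition (P2) of [IUTchIV] Cor. 2.2 (ii) asks that the prime `l` divide no local height `h_v` of the point. For the
lopsided points `λ_k` (parts I–IV) the multiset of local heights is unknown (it would require factorising `2π^{2k} + 1` and
`π^{2k} + 1`), but its SUM is bounded (`Σ_v h_v ≤ 2·Σ_U ord_U(y_k) ≤ 4·log(6·125^k)/log 2`, part IV). This file supplies: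

* **`exists_prime_not_dvd`** — for positive integers `h_i` (`i ∈ s`) and `3 ≤ L ≤ M` with
  `(log L/L)·Σ_i h_i < θ(M) − θ(L)`, SOME prime `l ∈ (L, M]` divides no `h_i` (the primes `l > L` dividing `h_i` have
  `Σ log l ≤ log h_i ≤ (log L/L)·h_i`, `log x/x` being decreasing on `[e, ∞)`; `θ(M) − θ(L) = Σ_{L < l ≤ M prime} log l`);
* `theta_sub_theta_ge` — `θ(M) − θ(10^{13}) ≥ M/2` for `M ≥ 10^{14}` (Chebyshev);
* **`exists_prime_window`** — for `k ≥ 10^{23}` and positive integers of sum `≤ 37k + 12`: a prime `l` with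
  `10^{13} < l`, `5·10^8·l ≤ k` dividing none of them;
* **`slack_lt_pair`** — the numeric envelope: for `10^{13} < l`, `5·10^8·l ≤ k`, `0 ≤ D ≤ 2`, `0 ≤ C ≤ 5 + 124k` and
  `Π` with `log(1105920·l)·Π ≤ 5·(1105920·l)` (Chebyshev; in the tree as abc-iut-s2-p3's
  `Cor22Window.log_mul_primeCounting_le`):
  abc-iut-S4's slack `(l+1)/4·((1 + 24/l)(D + C) + 2 log l + 52 + (20/3)·log(1105920·l)·Π) − ((l+5)/4 − 2)(D + (1−1/l)C)`
  is `< (l+1)·(2k)·log 5/48` (the pair term of a one-sided pole of depth `4k` at a split prime of weight `1/2`, part II).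
HONEST SCOPE: classical; nothing asserted about print or about Cor. 3.12. [cite: Mochizuki2012, IUTchIV Cor. 2.2 (ii) proof p. 44–45]
[claim: Mochizuki2012, status: disputed] for the IUT locator; the mathematics is Chebyshev 1852 as formalised in Mathlib.
-/

noncomputable section

namespace Summit.ABC.IUTFork

namespace LopsidedWitness

open Finset Real
open scoped Nat.Prime Chebyshev

/-! ## `θ(M) − θ(L)` is the sum of `log l` over the primes `L < l ≤ M` -/

/-- `θ(M) − θ(L) = Σ_{L < l ≤ M, l prime} log l` for naturals `L ≤ M`. [cite: Mochizuki2012, IUTchIV Cor. 2.2 (ii) proof p. 44–45] -/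
theorem theta_sub_theta_eq {L M : ℕ} (hLM : L ≤ M) :
    θ (M : ℝ) - θ (L : ℝ) = ∑ p ∈ (Finset.Ioc L M).filter Nat.Prime, Real.log p := by
  unfold Chebyshev.theta
  rw [Nat.floor_natCast, Nat.floor_natCast, Finset.sum_filter, Finset.sum_filter, Finset.sum_filter,
    ← Finset.sum_Ioc_consecutive _ (Nat.zero_le L) hLM]
  ring

/-! ## The counting lemma -/

/-- **Prime selection by counting.** If `h_i > 0` (`i ∈ s`), `3 ≤ L ≤ M` and `(log L/L)·Σ_i h_i < θ(M) − θ(L)`, then some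
prime `l` with `L < l ≤ M` divides NO `h_i`. (Otherwise every prime of `(L, M]` divides some `h_i`; the primes `> L`
dividing `h_i` have product `∣ h_i`, so `Σ log l ≤ log h_i ≤ (log L/L)·h_i` when `h_i > L` — `log x/x` decreases on
`[e, ∞)` — and contribute nothing when `h_i ≤ L`.) [cite: Mochizuki2012, IUTchIV Cor. 2.2 (ii) proof p. 44–45] -/
theorem exists_prime_not_dvd {ι : Type*} (s : Finset ι) (h : ι → ℕ) (hpos : ∀ i ∈ s, 0 < h i) {L M : ℕ}
    (hL : 3 ≤ L) (hLM : L ≤ M)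
    (hlt : Real.log L / L * ∑ i ∈ s, (h i : ℝ) < θ (M : ℝ) - θ (L : ℝ)) :
    ∃ l : ℕ, l.Prime ∧ L < l ∧ l ≤ M ∧ ∀ i ∈ s, ¬ l ∣ h i := by
  classical
  by_contra hne
  push Not at hne
  -- every prime of `(L, M]` divides some `h i`
  have hcover : ∀ l ∈ (Finset.Ioc L M).filter Nat.Prime, ∃ i ∈ s, l ∣ h i := by
    intro l hl
    rw [Finset.mem_filter, Finset.mem_Ioc] at hl
    exact hne l hl.2 hl.1.1 hl.1.2
  set P := (Finset.Ioc L M).filter Nat.Prime with hP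
  have hLpos : (0 : ℝ) < L := by exact_mod_cast (by omega : 0 < L)
  have hlogL : 0 ≤ Real.log L := Real.log_nonneg (by exact_mod_cast (by omega : 1 ≤ L))
  -- `θ(M) − θ(L) ≤ Σ_i Σ_{l ∈ P, l ∣ h i} log l`
  have h1 : θ (M : ℝ) - θ (L : ℝ) ≤ ∑ i ∈ s, ∑ l ∈ P with l ∣ h i, Real.log l := by
    rw [theta_sub_theta_eq hLM, ← hP]
    have hswap : ∑ i ∈ s, ∑ l ∈ P with l ∣ h i, Real.log l =
        ∑ l ∈ P, ∑ i ∈ s with l ∣ h i, Real.log l := by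
      rw [Finset.sum_comm' (t' := P) (s' := fun l => s.filter (fun i => l ∣ h i))]
      intro i l
      simp only [Finset.mem_filter]
      tauto
    rw [hswap]
    refine Finset.sum_le_sum fun l hl => ?_
    obtain ⟨i, hi, hdvd⟩ := hcover l hl
    have hlog : 0 ≤ Real.log l := Real.log_nonneg (by
      have := (Finset.mem_filter.mp hl).2.one_lt; exact_mod_cast this.le)
    calc Real.log l = ∑ j ∈ ({i} : Finset ι), Real.log l := by simp
      _ ≤ ∑ j ∈ s with l ∣ h j, Real.log l :=
        Finset.sum_le_sum_of_subset_of_nonneg (by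
          intro j hj; rw [Finset.mem_singleton] at hj; subst hj
          exact Finset.mem_filter.mpr ⟨hi, hdvd⟩) (fun _ _ _ => hlog)
  -- each inner sum is `≤ (log L/L)·h i`
  have h2 : ∀ i ∈ s, ∑ l ∈ P with l ∣ h i, Real.log l ≤ Real.log L / L * h i := by
    intro i hi
    have hi0 := hpos i hi
    by_cases hiL : h i ≤ L
    · -- no prime `> L` divides `h i`
      have hempty : P.filter (fun l => l ∣ h i) = ∅ := by
        refine Finset.filter_eq_empty_iff.mpr fun l hl hdvd => ?_
        rw [hP, Finset.mem_filter, Finset.mem_Ioc] at hl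
        have := Nat.le_of_dvd hi0 hdvd
        omega
      rw [hempty, Finset.sum_empty]
      exact mul_nonneg (div_nonneg hlogL hLpos.le) (Nat.cast_nonneg _)
    · push Not at hiL
      -- the product of the primes of `P` dividing `h i` divides `h i`
      have hprimes : ∀ l ∈ P.filter (fun l => l ∣ h i), l.Prime := fun l hl =>
        (Finset.mem_filter.mp (Finset.mem_filter.mp hl).1).2
      have hdvd : ∏ l ∈ P.filter (fun l => l ∣ h i), l ∣ h i :=
        Finset.prod_primes_dvd (h i) (fun l hl => Nat.prime_iff.mp (hprimes l hl))
          (fun l hl => (Finset.mem_filter.mp hl).2)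
      have hprodpos : 0 < ∏ l ∈ P.filter (fun l => l ∣ h i), l :=
        Finset.prod_pos fun l hl => (hprimes l hl).pos
      have hle : ((∏ l ∈ P.filter (fun l => l ∣ h i), l : ℕ) : ℝ) ≤ h i := by
        exact_mod_cast Nat.le_of_dvd hi0 hdvd
      have hsumlog : ∑ l ∈ P with l ∣ h i, Real.log l = Real.log ((∏ l ∈ P.filter (fun l => l ∣ h i), l : ℕ) : ℝ) := by
        rw [Nat.cast_prod, Real.log_prod]
        intro l hl
        exact_mod_cast (hprimes l hl).ne_zero
      rw [hsumlog]
      have hhi : (0 : ℝ) < h i := by exact_mod_cast hi0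
      calc Real.log ((∏ l ∈ P.filter (fun l => l ∣ h i), l : ℕ) : ℝ)
          ≤ Real.log (h i) := Real.log_le_log (by exact_mod_cast hprodpos) hle
        _ = Real.log (h i) / h i * h i := by field_simp
        _ ≤ Real.log L / L * h i := by
          refine mul_le_mul_of_nonneg_right ?_ hhi.le
          -- `log x / x` is antitone on `[e, ∞)`, and `e ≤ 3 ≤ L < h i`
          have he3 : Real.exp 1 ≤ 3 := by
            have := Real.exp_one_lt_d9; linarith
          have hLe : Real.exp 1 ≤ (L : ℝ) := he3.trans (by exact_mod_cast hL)
          have hie : Real.exp 1 ≤ (h i : ℝ) := hLe.trans (by exact_mod_cast hiL.le)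
          exact Real.log_div_self_antitoneOn hLe hie (by exact_mod_cast hiL.le)
  have h3 : ∑ i ∈ s, ∑ l ∈ P with l ∣ h i, Real.log l ≤ Real.log L / L * ∑ i ∈ s, (h i : ℝ) := by
    rw [Finset.mul_sum]
    exact Finset.sum_le_sum h2
  linarith

/-! ## Chebyshev: `θ(M) − θ(10^{13}) ≥ M/2` for `M ≥ 10^{14}` -/

/-- `log 2 ≤ 0.6932` and `0.693 ≤ log 2` (Mathlib's decimal bounds). [cite: Mochizuki2012, IUTchIV Cor. 2.2 (ii) proof p. 44–45] -/
theorem log_two_bounds : (0.693 : ℝ) ≤ Real.log 2 ∧ Real.log 2 ≤ 0.6932 := by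
  constructor
  · have := Real.log_two_gt_d9; linarith
  · have := Real.log_two_lt_d9; linarith

/-- **`θ(M) − θ(10^{13}) ≥ M/2` for every natural `M ≥ 10^{14}`** (`θ(M) ≥ M log 2 − log(M+1) − 2√M log M`,
`θ(10^{13}) ≤ 10^{13}·log 4`; `log(M+1) ≤ 3√M`, `log M ≤ 4·M^{1/4}`, `√M ≤ M/10^7`, `M^{3/4} ≤ M/3162`).
[cite: Mochizuki2012, IUTchIV Cor. 2.2 (ii) proof p. 44–45] -/
theorem theta_sub_theta_ge {M : ℕ} (hM : (10 : ℕ) ^ 14 ≤ M) :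
    (M : ℝ) / 2 ≤ θ (M : ℝ) - θ (((10 : ℕ) ^ 13 : ℕ) : ℝ) := by
  have hMr : (10 : ℝ) ^ 14 ≤ M := by exact_mod_cast hM
  have hM0 : (0 : ℝ) < M := by linarith
  have hge := Chebyshev.theta_ge M
  have hle := Chebyshev.theta_le_log4_mul_x (x := (((10 : ℕ) ^ 13 : ℕ) : ℝ)) (by positivity)
  obtain ⟨hlog2, hlog2'⟩ := log_two_bounds
  have hlog4 : Real.log 4 = 2 * Real.log 2 := by
    rw [show (4 : ℝ) = 2 ^ 2 by norm_num, Real.log_pow]; norm_num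
  -- `t := M^{1/4}`
  set r := Real.sqrt (M : ℝ) with hr
  set t := Real.sqrt r with ht
  have hr0 : 0 ≤ r := Real.sqrt_nonneg _
  have ht0 : 0 ≤ t := Real.sqrt_nonneg _
  have hr2 : r ^ 2 = M := Real.sq_sqrt hM0.le
  have ht2 : t ^ 2 = r := Real.sq_sqrt hr0
  -- `r ≥ 10^7`, `t ≥ 3162`
  have hr7 : (10 : ℝ) ^ 7 ≤ r := by
    by_contra hlt
    push Not at hlt
    have : r ^ 2 < (10 ^ 7) ^ 2 := by
      exact pow_lt_pow_left₀ hlt hr0 (by norm_num)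
    linarith
  have ht3 : (3162 : ℝ) ≤ t := by
    by_contra hlt
    push Not at hlt
    have : t ^ 2 < 3162 ^ 2 := pow_lt_pow_left₀ hlt ht0 (by norm_num)
    linarith
  have ht0' : 0 < t := by linarith
  have hr0' : 0 < r := by linarith
  -- `log M = 4 log t`, `log t ≤ t − 1`
  have hlogM : Real.log M = 4 * Real.log t := by
    rw [← hr2, ← ht2, ← pow_mul, Real.log_pow]; norm_num
  have hlogt : Real.log t ≤ t - 1 := Real.log_le_sub_one_of_pos ht0'
  have hMlog : 0.693 * (M : ℝ) ≤ (M : ℝ) * Real.log 2 := by nlinarith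
  have hsqrt : 2 * r * Real.log M ≤ (M : ℝ) / 395 := by
    rw [hlogM, ← hr2, ← ht2]
    -- `2 t² · 4 log t ≤ 8 t³ ≤ t⁴/395` since `t ≥ 3162`
    have h8 : 2 * t ^ 2 * (4 * Real.log t) ≤ 8 * t ^ 3 := by nlinarith [sq_nonneg t]
    have h9 : 8 * t ^ 3 ≤ (t ^ 2) ^ 2 / 395 := by
      rw [le_div_iff₀ (by norm_num : (0 : ℝ) < 395)]
      nlinarith [pow_pos ht0' 3]
    linarith
  -- `log(M+1) ≤ 3 r`: `log(M+1) = 2 log √(M+1) ≤ 2 √(M+1) ≤ 2 √(2M) ≤ 3 r`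
  have hlogM1 : Real.log ((M : ℝ) + 1) ≤ (M : ℝ) / 10 ^ 6 := by
    have h1 : Real.log ((M : ℝ) + 1) ≤ (M : ℝ) + 1 - 1 := Real.log_le_sub_one_of_pos (by linarith)
    -- sharper: via the square root
    set u := Real.sqrt ((M : ℝ) + 1) with hu
    have hu0 : 0 < u := Real.sqrt_pos.mpr (by linarith)
    have hu2 : u ^ 2 = (M : ℝ) + 1 := Real.sq_sqrt (by linarith)
    have hlogu : Real.log ((M : ℝ) + 1) = 2 * Real.log u := by rw [← hu2, Real.log_pow]; norm_num
    have hlu : Real.log u ≤ u - 1 := Real.log_le_sub_one_of_pos hu0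
    -- `u ≤ 2 r` since `M + 1 ≤ 4 M`
    have hur : u ≤ 2 * r := by
      by_contra hlt
      push Not at hlt
      have : (2 * r) ^ 2 < u ^ 2 := pow_lt_pow_left₀ hlt (by linarith) (by norm_num)
      nlinarith
    -- `r ≤ M / 10^7`
    have hrM : r ≤ (M : ℝ) / 10 ^ 7 := by
      rw [le_div_iff₀ (by norm_num : (0 : ℝ) < 10 ^ 7), ← hr2]
      nlinarith
    nlinarith
  have hL : Real.log 4 * (((10 : ℕ) ^ 13 : ℕ) : ℝ) ≤ (M : ℝ) * 0.13864 := by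
    rw [hlog4]; push_cast; nlinarith
  clear_value t r
  have key : (M : ℝ) * Real.log 2 - Real.log ((M : ℝ) + 1) - 2 * r * Real.log M
      - Real.log 4 * (((10 : ℕ) ^ 13 : ℕ) : ℝ) ≤ θ (M : ℝ) - θ (((10 : ℕ) ^ 13 : ℕ) : ℝ) := by linarith
  have key2 : (M : ℝ) / 2 ≤ (M : ℝ) * Real.log 2 - Real.log ((M : ℝ) + 1) - 2 * r * Real.log M
      - Real.log 4 * (((10 : ℕ) ^ 13 : ℕ) : ℝ) := by linarith
  exact key2.trans key

/-! ## The window `(10^{13}, k/(5·10^8)]` -/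

/-- **For `k ≥ 10^{23}` and positive integers of sum `≤ 37k + 12`, some prime `l` with `10^{13} < l`, `5·10^8·l ≤ k`
divides none of them.** (`L = 10^{13}`, `M = ⌊k/(5·10^8)⌋ ≥ 10^{14}`; `(log L/L)·(37k + 12) < M/2 ≤ θ(M) − θ(L)`.)
[cite: Mochizuki2012, IUTchIV Cor. 2.2 (ii) proof p. 44–45] -/
theorem exists_prime_window {ι : Type*} (s : Finset ι) (h : ι → ℕ) (hpos : ∀ i ∈ s, 0 < h i) {k : ℕ}
    (hk : (10 : ℕ) ^ 23 ≤ k) (hsum : ∑ i ∈ s, (h i : ℝ) ≤ 37 * k + 12) :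
    ∃ l : ℕ, l.Prime ∧ (10 : ℕ) ^ 13 < l ∧ 500000000 * l ≤ k ∧ ∀ i ∈ s, ¬ l ∣ h i := by
  set M : ℕ := k / 500000000 with hMdef
  have hkr : (10 : ℝ) ^ 23 ≤ k := by exact_mod_cast hk
  -- `M ≥ 10^14` and `(M : ℝ) ≥ k/(5·10^8) − 1`
  have hM14 : (10 : ℕ) ^ 14 ≤ M := by
    rw [hMdef, Nat.le_div_iff_mul_le (by norm_num)]
    calc (10 : ℕ) ^ 14 * 500000000 ≤ 10 ^ 23 := by norm_num
      _ ≤ k := hk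
  have hMr : (k : ℝ) / 500000000 - 1 ≤ (M : ℝ) := by
    have h := Nat.lt_div_mul_add (a := k) (b := 500000000) (by norm_num)
    rw [← hMdef] at h
    have h' : (k : ℝ) < (M : ℝ) * 500000000 + 500000000 := by exact_mod_cast h
    rw [div_sub_one (by norm_num), div_le_iff₀ (by norm_num)]
    linarith
  have hLM : (10 : ℕ) ^ 13 ≤ M := le_trans (by norm_num) hM14
  obtain ⟨l, hl, hLl, hlM, hndvd⟩ := exists_prime_not_dvd s h hpos (L := (10 : ℕ) ^ 13) (M := M)
    (by norm_num) hLM (by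
      have hθ := theta_sub_theta_ge hM14
      -- `log(10^13) ≤ 13·4·log 2 ≤ 36.05` via `10 ≤ 16`
      obtain ⟨-, hlog2'⟩ := log_two_bounds
      have hlog10 : Real.log 10 ≤ 4 * Real.log 2 := by
        rw [show (4 : ℝ) * Real.log 2 = Real.log (2 ^ 4) by rw [Real.log_pow]; norm_num]
        exact Real.log_le_log (by norm_num) (by norm_num)
      have hcast : ((((10 : ℕ) ^ 13 : ℕ)) : ℝ) = (10 : ℝ) ^ 13 := by norm_num
      have hlogL : Real.log ((((10 : ℕ) ^ 13 : ℕ)) : ℝ) ≤ 36.05 := by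
        rw [hcast, Real.log_pow]; push_cast; nlinarith
      have hsum0 : 0 ≤ ∑ i ∈ s, (h i : ℝ) := Finset.sum_nonneg fun i _ => Nat.cast_nonneg _
      have hq : Real.log ((((10 : ℕ) ^ 13 : ℕ)) : ℝ) / ((((10 : ℕ) ^ 13 : ℕ)) : ℝ) ≤ 36.05 / (10 : ℝ) ^ 13 := by
        rw [hcast] at hlogL ⊢
        exact div_le_div_of_nonneg_right hlogL (by positivity)
      have hb : Real.log ((((10 : ℕ) ^ 13 : ℕ)) : ℝ) / ((((10 : ℕ) ^ 13 : ℕ)) : ℝ) * ∑ i ∈ s, (h i : ℝ) ≤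
          36.05 / (10 : ℝ) ^ 13 * (37 * k + 12) :=
        calc Real.log ((((10 : ℕ) ^ 13 : ℕ)) : ℝ) / ((((10 : ℕ) ^ 13 : ℕ)) : ℝ) * ∑ i ∈ s, (h i : ℝ)
            ≤ 36.05 / (10 : ℝ) ^ 13 * ∑ i ∈ s, (h i : ℝ) := mul_le_mul_of_nonneg_right hq hsum0
          _ ≤ 36.05 / (10 : ℝ) ^ 13 * (37 * k + 12) := mul_le_mul_of_nonneg_left hsum (by positivity)
      linarith)
  refine ⟨l, hl, hLl, ?_, hndvd⟩
  calc 500000000 * l ≤ 500000000 * M := Nat.mul_le_mul_left _ hlM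
    _ = k / 500000000 * 500000000 := by rw [hMdef, mul_comm]
    _ ≤ k := Nat.div_mul_le_self k 500000000

/-! ## The numeric envelope of the pair inequality -/

/-- **The numeric envelope.** For `10^{13} < l`, `5·10^8·l ≤ k`, `0 ≤ D ≤ 2`, `0 ≤ C ≤ 5 + 124k`, `Π` with
`log(1105920·l)·Π ≤ 5·(1105920·l)`: abc-iut-S4's slack at `d_mod = 2` is below the pair term of depth `4k`:
`(l+1)/4·((1 + 24/l)(D+C) + 2 log l + 52 + (20/3)·log(1105920·l)·Π) − ((l+5)/4 − 2)·(D + (1 − 1/l)·C) < (l+1)·(2k)·log 5/48`.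
(The slack equals `(D+C)(7 + 6/l) + C(l−3)/(4l) + (l+1)/4·(2 log l + 52 + (20/3) log(1105920 l)·Π) ≤ 0.02·(l+1)·k`,
the pair is `≥ 0.057·(l+1)·k` since `log 5 ≥ log 4 ≥ 1.386`.) [cite: Mochizuki2012, IUTchIV Thm. 1.10 Step (viii) p. 29]
[claim: Mochizuki2012, status: disputed] -/
theorem slack_lt_pair {l k : ℕ} (hl : (10 : ℕ) ^ 13 < l) (hlk : 500000000 * l ≤ k) {D C Pi : ℝ}
    (hD0 : 0 ≤ D) (hD : D ≤ 2) (hC0 : 0 ≤ C) (hC : C ≤ 5 + 124 * k)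
    (hPi : Real.log ((1105920 : ℝ) * l) * Pi ≤ 5 * (1105920 * l)) :
    ((l : ℝ) + 1) / 4 *
          ((1 + 12 * (2 : ℝ) / l) * (D + C) + 2 * Real.log l + 52 + 20 / 3 * Real.log ((1105920 : ℝ) * l) * Pi)
        - (((l : ℝ) + 5) / 4 - (2 : ℝ)) * (D + (1 - 1 / (l : ℝ)) * C) <
      ((l : ℝ) + 1) * (2 * (k : ℝ)) * Real.log 5 / 48 := by
  have hlr : (10 : ℝ) ^ 13 < l := by exact_mod_cast hl
  have hl0 : (0 : ℝ) < l := by linarith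
  have hlkr : (500000000 : ℝ) * l ≤ k := by exact_mod_cast hlk
  have hk0 : (0 : ℝ) < k := by linarith
  -- the slack in additive form
  have e : ((l : ℝ) + 1) / 4 *
          ((1 + 12 * (2 : ℝ) / l) * (D + C) + 2 * Real.log l + 52 + 20 / 3 * Real.log ((1105920 : ℝ) * l) * Pi)
        - (((l : ℝ) + 5) / 4 - (2 : ℝ)) * (D + (1 - 1 / (l : ℝ)) * C) =
      (D + C) * (7 + 6 / l) + C * ((l : ℝ) - 3) / (4 * l) +
        ((l : ℝ) + 1) / 4 * (2 * Real.log l + 52 + 20 / 3 * Real.log ((1105920 : ℝ) * l) * Pi) := by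
    field_simp
    ring
  rw [e]
  -- piece 1: `(D + C)(7 + 6/l) ≤ 8 (D + C)`
  have h6l : (6 : ℝ) / l ≤ 1 := by rw [div_le_one hl0]; linarith
  have p1 : (D + C) * (7 + 6 / l) ≤ 8 * (D + C) := by nlinarith
  -- piece 2: `C (l−3)/(4l) ≤ C/4`
  have p2 : C * ((l : ℝ) - 3) / (4 * l) ≤ C / 4 := by
    rw [div_le_div_iff₀ (by positivity) (by norm_num)]
    nlinarith
  -- piece 3: `2 log l + 52 + (20/3) log(N) Π ≤ 3.7·10^7 · l`
  have hlogl : Real.log l ≤ l := by linarith [Real.log_le_sub_one_of_pos hl0]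
  have p3 : 2 * Real.log l + 52 + 20 / 3 * Real.log ((1105920 : ℝ) * l) * Pi ≤ 37000000 * l := by nlinarith
  have p3' : ((l : ℝ) + 1) / 4 * (2 * Real.log l + 52 + 20 / 3 * Real.log ((1105920 : ℝ) * l) * Pi) ≤
      ((l : ℝ) + 1) / 4 * (37000000 * l) := mul_le_mul_of_nonneg_left p3 (by positivity)
  -- compare with `(l+1)·k`
  have hX : ((l : ℝ) + 1) / 4 * (37000000 * l) ≤ ((l : ℝ) + 1) * k * 0.0185 := by nlinarith
  have hsmall : 8 * (D + C) + C / 4 ≤ ((l : ℝ) + 1) * k * 0.001 := by nlinarith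
  -- the pair: `log 5 ≥ log 4 = 2 log 2 ≥ 1.386`
  have hlog5 : (1.386 : ℝ) ≤ Real.log 5 := by
    obtain ⟨hlog2, -⟩ := log_two_bounds
    have h4 : Real.log 4 ≤ Real.log 5 := Real.log_le_log (by norm_num) (by norm_num)
    have hlog4 : Real.log 4 = 2 * Real.log 2 := by
      rw [show (4 : ℝ) = 2 ^ 2 by norm_num, Real.log_pow]; norm_num
    linarith
  have hpair : ((l : ℝ) + 1) * k * 0.05775 ≤ ((l : ℝ) + 1) * (2 * (k : ℝ)) * Real.log 5 / 48 := by nlinarith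
  nlinarith

end LopsidedWitness

end Summit.ABC.IUTFork

end
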